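import Mathlib
import HarnessLib

/-!
# Route `KLProgramme` — ENGINE child gen 8 (stmt-HubbardSuperconductivity-20437 `KLRegimeEngineV17F2`), stub (c) `stub_engine_step_values`,
# (E2-v10)/E.5 lane: the LINE-NUMBER TAIL SUMMATION after the hybrid (explicit + Gram) bridge
# (cell gate-hubbard-kl, seat p5 g6; packaging asked for in HOME/prover-p5/E5-GAIN-SCALE-N.md §7 «NEXT (3)»)

The g5 bridge (`…WickCrossContractionGramFamily(Norm)`, `…GramValue`, `…GramSized`) bounds the `k`-line two-vertex term with `e = e' + 1`
explicit lines by

  `((k + m₀)! (k + m₁)! / (m! (k − e)!)) · (Σ_{s∈ι} κ_s²)^{k − e} · A`,   `A = α · ∏_{i<e'} (δ_i · 4ρ₀) · Na · Nb`,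

with a Gram base `x = Σ_{s∈ι} κ_s²` INDEPENDENT of `k` (family keying).  Against the `(k!)⁻¹` of the exponential series (discrete organisation,
`klw_wickPairAmplitude_succ_lines`) or the `(l!)⁻¹ = k/k!` of the continuous source (`klws_flow_source_eq`: one `Ċ_Λ` line, `l = k − 1` lines `D_Λ`)
the line-number tail is a polynomially weighted geometric series.  This file sums it in closed form, `N`-uniformly (the sum runs to
`N = |HubbardFieldIdx × Fin 2| + 2` in the model — the bound must not see `N`):

* §1 `klgt_choose_mul_choose_le` (`C(k+a,a)·C(k+b,b) ≤ C(a+b,a)·C(k+a+b,a+b)`), `klgt_coeff_le` (ℕ: `(k+a)!(k+b)! ≤ (a+b+e)!·C(k+a+b,a+b+e)·k!·(k−e)!`),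
  `klgt_coeff_div_le` (ℝ form of the coefficient bound);
* §2 `klgt_sum_choose_mul_pow_le` (`Σ_{j∈s} C(j+c,c) x^j ≤ (1−x)^{−(c+1)}`), **`klgt_sum_Icc_tailCoeff_le`**
  (`Σ_{k=e}^{N} (k+a)!(k+b)!/(k!·m!·(k−e)!)·x^{k−e} ≤ (a+b+e)!/(m!·(1−x)^{a+b+e+1})`), **`klgt_sum_Icc_tailCoeff_mul_le`** (the `k·`-weighted sum:
  `≤ (a+b+e+1)!/(m!·(1−x)^{a+b+e+2})`), and the `x ≤ 1/2` numerals;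
* §3 consumer forms **`klgt_norm_sum_le_of_tail`** / **`klgt_norm_sum_le_of_tail_mul`**: per-`k` bounds of the bridge's shape (weight `(k!)⁻¹`, resp.
  `((k−1)!)⁻¹`) on `Icc e N` ⟹ the norm of the sum is `≤ closed form × A`.

Pure real analysis / combinatorics; no definitions, no named facts, nothing about the model is asserted.
-/

namespace Summit.HubbardSuperconductivity.HubbardSuperconductivity.Theorems.KLRegimeWick

set_option linter.dupNamespace false -- summit = problem name (single-conjunct summit), D-0017

open Finset Nat

/-! ## §1 The coefficient -/

/-- `C(k+a,a)·C(k+b,b) ≤ C(a+b,a)·C(k+a+b,a+b)` (product of two binomials along `k` against one binomial of the summed order). -/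
theorem klgt_choose_mul_choose_le (k a b : ℕ) :
    (k + a).choose a * (k + b).choose b ≤ (a + b).choose a * (k + a + b).choose (a + b) := by
  have h1 : (k + a).choose a ≤ (k + a + b).choose a := Nat.choose_le_choose a (Nat.le_add_right _ _)
  have h2 : (k + a + b).choose (a + b) * (a + b).choose a = (k + a + b).choose a * (k + b).choose b := by
    have h := Nat.choose_mul (n := k + a + b) (k := a + b) (s := a) (Nat.le_add_right a b)
    rwa [show k + a + b - a = k + b by omega, show a + b - a = b by omega] at h
  calc (k + a).choose a * (k + b).choose b ≤ (k + a + b).choose a * (k + b).choose b := Nat.mul_le_mul_right _ h1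
    _ = (a + b).choose a * (k + a + b).choose (a + b) := by rw [← h2, Nat.mul_comm]

/-- **The tail coefficient in `ℕ`**: for `e ≤ k`, `(k+a)!·(k+b)! ≤ (a+b+e)!·C(k+a+b, a+b+e)·k!·(k−e)!`. -/
theorem klgt_coeff_le {k e : ℕ} (hek : e ≤ k) (a b : ℕ) :
    (k + a)! * (k + b)! ≤ (a + b + e)! * (k + a + b).choose (a + b + e) * k ! * (k - e)! := by
  have ha : (k + a)! = (k + a).choose a * k ! * a ! := (Nat.add_choose_mul_factorial_mul_factorial k a).symm
  have hb : (k + b)! = (k + b).choose b * k ! * b ! := (Nat.add_choose_mul_factorial_mul_factorial k b).symm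
  have hk : k ! = k.choose e * e ! * (k - e)! := (Nat.choose_mul_factorial_mul_factorial hek).symm
  have hab : (a + b).choose a * a ! * b ! = (a + b)! := by
    have h := Nat.add_choose_mul_factorial_mul_factorial b a
    rw [Nat.add_comm b a] at h
    calc (a + b).choose a * a ! * b ! = (a + b).choose a * b ! * a ! := by ring
      _ = (a + b)! := h
  have habe : (a + b + e).choose (a + b) * (a + b)! * e ! = (a + b + e)! := by
    have h := Nat.choose_mul_factorial_mul_factorial (Nat.le_add_right (a + b) e)
    rwa [show a + b + e - (a + b) = e by omega] at h
  have hsplit : (k + a + b).choose (a + b + e) * (a + b + e).choose (a + b) = (k + a + b).choose (a + b) * k.choose e := by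
    have h := Nat.choose_mul (n := k + a + b) (k := a + b + e) (s := a + b) (Nat.le_add_right (a + b) e)
    rwa [show k + a + b - (a + b) = k by omega, show a + b + e - (a + b) = e by omega] at h
  have hA := klgt_choose_mul_choose_le k a b
  calc (k + a)! * (k + b)!
      = (k + a).choose a * (k + b).choose b * (a ! * b ! * k !) * k ! := by rw [ha, hb]; ring
    _ ≤ (a + b).choose a * (k + a + b).choose (a + b) * (a ! * b ! * k !) * k ! :=
        Nat.mul_le_mul_right _ (Nat.mul_le_mul_right _ hA)
    _ = (a + b).choose a * (k + a + b).choose (a + b) * (a ! * b ! * k !) * (k.choose e * e ! * (k - e)!) := by rw [← hk]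
    _ = ((a + b).choose a * a ! * b !) * ((k + a + b).choose (a + b) * k.choose e) * e ! * k ! * (k - e)! := by ring
    _ = (a + b)! * ((k + a + b).choose (a + b + e) * (a + b + e).choose (a + b)) * e ! * k ! * (k - e)! := by rw [hab, hsplit]
    _ = ((a + b + e).choose (a + b) * (a + b)! * e !) * (k + a + b).choose (a + b + e) * k ! * (k - e)! := by ring
    _ = (a + b + e)! * (k + a + b).choose (a + b + e) * k ! * (k - e)! := by rw [habe]

/-- **The tail coefficient, real form**: for `e ≤ k`,
`(k+a)!(k+b)!/(k!·m!·(k−e)!) ≤ ((a+b+e)!/m!)·C((k−e)+(a+b+e), a+b+e)`. -/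
theorem klgt_coeff_div_le {k e : ℕ} (hek : e ≤ k) (a b m : ℕ) :
    ((k + a)! * (k + b)! : ℝ) / (k ! * m ! * (k - e)!) ≤ ((a + b + e)! : ℝ) / m ! * ((k - e + (a + b + e)).choose (a + b + e) : ℝ) := by
  have hpos : (0 : ℝ) < k ! * m ! * (k - e)! := by positivity
  rw [div_le_iff₀ hpos, show k - e + (a + b + e) = k + a + b by omega]
  have h := klgt_coeff_le hek a b
  have h' : ((k + a)! * (k + b)! : ℝ) ≤ ((a + b + e)! * (k + a + b).choose (a + b + e) * k ! * (k - e)! : ℕ) := by exact_mod_cast h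
  have hm : (0 : ℝ) < m ! := by positivity
  calc ((k + a)! * (k + b)! : ℝ) ≤ ((a + b + e)! * (k + a + b).choose (a + b + e) * k ! * (k - e)! : ℕ) := h'
    _ = ((a + b + e)! : ℝ) / m ! * ((k + a + b).choose (a + b + e) : ℝ) * (k ! * m ! * (k - e)!) := by
        field_simp
        push_cast
        ring

/-! ## §2 Tail sums -/

/-- `Σ_{j ∈ s} C(j+c,c)·x^j ≤ 1/(1−x)^{c+1}` for `0 ≤ x < 1` and any finite index set. -/
theorem klgt_sum_choose_mul_pow_le {x : ℝ} (hx0 : 0 ≤ x) (hx1 : x < 1) (c : ℕ) (s : Finset ℕ) :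
    ∑ j ∈ s, ((j + c).choose c : ℝ) * x ^ j ≤ 1 / (1 - x) ^ (c + 1) := by
  have hx : ‖x‖ < 1 := by rw [Real.norm_eq_abs, abs_of_nonneg hx0]; exact hx1
  exact sum_le_hasSum s (fun j _ => by positivity) (hasSum_choose_mul_geometric_of_norm_lt_one c hx)

/-- `Σ_{j ∈ s} (j+e)·C(j+c,c)·x^j ≤ (c+1)/(1−x)^{c+2}` for `e ≤ c`, `0 ≤ x < 1`. -/
theorem klgt_sum_mul_choose_mul_pow_le {x : ℝ} (hx0 : 0 ≤ x) (hx1 : x < 1) {e c : ℕ} (hec : e ≤ c) (s : Finset ℕ) :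
    ∑ j ∈ s, ((j + e : ℕ) : ℝ) * (((j + c).choose c : ℝ) * x ^ j) ≤ (c + 1 : ℝ) / (1 - x) ^ (c + 2) := by
  have hterm : ∀ j ∈ s, ((j + e : ℕ) : ℝ) * (((j + c).choose c : ℝ) * x ^ j) ≤ (c + 1 : ℝ) * (((j + (c + 1)).choose (c + 1) : ℝ) * x ^ j) := by
    intro j _
    have h1 : (j + e) * (j + c).choose c ≤ (c + 1) * (j + (c + 1)).choose (c + 1) := by
      have h := Nat.add_one_mul_choose_eq (j + c) c
      rw [show j + c + 1 = j + (c + 1) by omega] at h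
      calc (j + e) * (j + c).choose c ≤ (j + (c + 1)) * (j + c).choose c := Nat.mul_le_mul_right _ (by omega)
        _ = (j + (c + 1)).choose (c + 1) * (c + 1) := h
        _ = (c + 1) * (j + (c + 1)).choose (c + 1) := Nat.mul_comm _ _
    have h1' : ((j + e : ℕ) : ℝ) * ((j + c).choose c : ℝ) ≤ (c + 1 : ℝ) * ((j + (c + 1)).choose (c + 1) : ℝ) := by exact_mod_cast h1
    have hxj : (0 : ℝ) ≤ x ^ j := by positivity
    nlinarith
  calc ∑ j ∈ s, ((j + e : ℕ) : ℝ) * (((j + c).choose c : ℝ) * x ^ j)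
      ≤ ∑ j ∈ s, (c + 1 : ℝ) * (((j + (c + 1)).choose (c + 1) : ℝ) * x ^ j) := sum_le_sum hterm
    _ = (c + 1 : ℝ) * ∑ j ∈ s, ((j + (c + 1)).choose (c + 1) : ℝ) * x ^ j := by rw [mul_sum]
    _ ≤ (c + 1 : ℝ) * (1 / (1 - x) ^ (c + 1 + 1)) :=
        mul_le_mul_of_nonneg_left (klgt_sum_choose_mul_pow_le hx0 hx1 (c + 1) s) (by positivity)
    _ = (c + 1 : ℝ) / (1 - x) ^ (c + 2) := by rw [show c + 1 + 1 = c + 2 by omega]; ring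

/-- **Line-number tail, shifted index**: `Σ_{j<N} (j+e+a)!(j+e+b)!/((j+e)!·m!·j!)·x^j ≤ (a+b+e)!/(m!·(1−x)^{a+b+e+1})`. -/
theorem klgt_sum_range_tailCoeff_le {x : ℝ} (hx0 : 0 ≤ x) (hx1 : x < 1) (a b e m N : ℕ) :
    ∑ j ∈ range N, ((j + e + a)! * (j + e + b)! : ℝ) / ((j + e)! * m ! * j !) * x ^ j ≤
      ((a + b + e)! : ℝ) / (m ! * (1 - x) ^ (a + b + e + 1)) := by
  have hterm : ∀ j ∈ range N, ((j + e + a)! * (j + e + b)! : ℝ) / ((j + e)! * m ! * j !) * x ^ j ≤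
      ((a + b + e)! : ℝ) / m ! * (((j + (a + b + e)).choose (a + b + e) : ℝ) * x ^ j) := by
    intro j _
    have h := klgt_coeff_div_le (Nat.le_add_left e j) a b m
    rw [show j + e - e = j by omega] at h
    have hxj : (0 : ℝ) ≤ x ^ j := by positivity
    calc ((j + e + a)! * (j + e + b)! : ℝ) / ((j + e)! * m ! * j !) * x ^ j
        ≤ ((a + b + e)! : ℝ) / m ! * ((j + (a + b + e)).choose (a + b + e) : ℝ) * x ^ j := mul_le_mul_of_nonneg_right h hxj
      _ = _ := by ring
  calc ∑ j ∈ range N, ((j + e + a)! * (j + e + b)! : ℝ) / ((j + e)! * m ! * j !) * x ^ j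
      ≤ ∑ j ∈ range N, ((a + b + e)! : ℝ) / m ! * (((j + (a + b + e)).choose (a + b + e) : ℝ) * x ^ j) := sum_le_sum hterm
    _ = ((a + b + e)! : ℝ) / m ! * ∑ j ∈ range N, ((j + (a + b + e)).choose (a + b + e) : ℝ) * x ^ j := by rw [mul_sum]
    _ ≤ ((a + b + e)! : ℝ) / m ! * (1 / (1 - x) ^ (a + b + e + 1)) :=
        mul_le_mul_of_nonneg_left (klgt_sum_choose_mul_pow_le hx0 hx1 _ _) (by positivity)
    _ = ((a + b + e)! : ℝ) / (m ! * (1 - x) ^ (a + b + e + 1)) := by rw [mul_one_div, div_div]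

/-- **Line-number tail**: `Σ_{k=e}^{N} (k+a)!(k+b)!/(k!·m!·(k−e)!)·x^{k−e} ≤ (a+b+e)!/(m!·(1−x)^{a+b+e+1})`, uniformly in `N`. -/
theorem klgt_sum_Icc_tailCoeff_le {x : ℝ} (hx0 : 0 ≤ x) (hx1 : x < 1) (a b e m N : ℕ) :
    ∑ k ∈ Icc e N, ((k + a)! * (k + b)! : ℝ) / (k ! * m ! * (k - e)!) * x ^ (k - e) ≤
      ((a + b + e)! : ℝ) / (m ! * (1 - x) ^ (a + b + e + 1)) := by
  rw [← Finset.Ico_add_one_right_eq_Icc, sum_Ico_eq_sum_range]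
  have h := klgt_sum_range_tailCoeff_le hx0 hx1 a b e m (N + 1 - e)
  refine le_trans (le_of_eq (sum_congr rfl fun j _ => ?_)) h
  rw [show e + j - e = j by omega, show e + j + a = j + e + a by ring, show e + j + b = j + e + b by ring, show e + j = j + e by ring]

/-- **Line-number tail, `k`-weighted** (the continuous source's `(l!)⁻¹ = k/k!`, `l = k − 1`):
`Σ_{k=e}^{N} k·(k+a)!(k+b)!/(k!·m!·(k−e)!)·x^{k−e} ≤ (a+b+e+1)!/(m!·(1−x)^{a+b+e+2})`. -/
theorem klgt_sum_Icc_tailCoeff_mul_le {x : ℝ} (hx0 : 0 ≤ x) (hx1 : x < 1) (a b e m N : ℕ) :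
    ∑ k ∈ Icc e N, (k : ℝ) * (((k + a)! * (k + b)! : ℝ) / (k ! * m ! * (k - e)!)) * x ^ (k - e) ≤
      ((a + b + e + 1)! : ℝ) / (m ! * (1 - x) ^ (a + b + e + 2)) := by
  rw [← Finset.Ico_add_one_right_eq_Icc, sum_Ico_eq_sum_range]
  set N' := N + 1 - e
  have hterm : ∀ j ∈ range N', ((e + j : ℕ) : ℝ) * ((((e + j) + a)! * ((e + j) + b)! : ℝ) / ((e + j)! * m ! * (e + j - e)!)) * x ^ (e + j - e) ≤
      ((a + b + e)! : ℝ) / m ! * (((j + e : ℕ) : ℝ) * ((((j + (a + b + e)).choose (a + b + e) : ℝ)) * x ^ j)) := by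
    intro j _
    have h := klgt_coeff_div_le (Nat.le_add_right e j) a b m
    rw [show e + j - e = j by omega] at h ⊢
    have hxj : (0 : ℝ) ≤ x ^ j := by positivity
    have hej : (0 : ℝ) ≤ ((e + j : ℕ) : ℝ) := by positivity
    rw [show j + e = e + j by ring]
    calc ((e + j : ℕ) : ℝ) * (((e + j + a)! * (e + j + b)! : ℝ) / ((e + j)! * m ! * j !)) * x ^ j
        ≤ ((e + j : ℕ) : ℝ) * (((a + b + e)! : ℝ) / m ! * ((j + (a + b + e)).choose (a + b + e) : ℝ)) * x ^ j :=
          mul_le_mul_of_nonneg_right (mul_le_mul_of_nonneg_left h hej) hxj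
      _ = _ := by push_cast; ring
  calc ∑ j ∈ range N', ((e + j : ℕ) : ℝ) * ((((e + j) + a)! * ((e + j) + b)! : ℝ) / ((e + j)! * m ! * (e + j - e)!)) * x ^ (e + j - e)
      ≤ ∑ j ∈ range N', ((a + b + e)! : ℝ) / m ! * (((j + e : ℕ) : ℝ) * ((((j + (a + b + e)).choose (a + b + e) : ℝ)) * x ^ j)) :=
        sum_le_sum hterm
    _ = ((a + b + e)! : ℝ) / m ! * ∑ j ∈ range N', ((j + e : ℕ) : ℝ) * ((((j + (a + b + e)).choose (a + b + e) : ℝ)) * x ^ j) := by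
        rw [mul_sum]
    _ ≤ ((a + b + e)! : ℝ) / m ! * (((a + b + e : ℕ) + 1 : ℝ) / (1 - x) ^ (a + b + e + 2)) :=
        mul_le_mul_of_nonneg_left (klgt_sum_mul_choose_mul_pow_le hx0 hx1 (by omega : e ≤ a + b + e) _) (by positivity)
    _ = ((a + b + e + 1)! : ℝ) / (m ! * (1 - x) ^ (a + b + e + 2)) := by
        have hx' : (1 - x) ^ (a + b + e + 2) ≠ 0 := pow_ne_zero _ (by linarith)
        have hm : (m ! : ℝ) ≠ 0 := by positivity
        rw [Nat.factorial_succ (a + b + e)]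
        field_simp
        push_cast
        ring

/-- Numeral: for `x ≤ 1/2`, `1/(1−x)^{c} ≤ 2^{c}`. -/
theorem klgt_one_div_one_sub_pow_le {x : ℝ} (hx : x ≤ 1 / 2) (c : ℕ) : 1 / (1 - x) ^ c ≤ (2 : ℝ) ^ c := by
  have h1 : (1 : ℝ) / 2 ≤ 1 - x := by linarith
  rw [div_le_iff₀ (by positivity), ← mul_pow]
  exact one_le_pow₀ (by linarith)

/-- **Line-number tail at `x ≤ 1/2`**: `Σ_{k=e}^{N} (k+a)!(k+b)!/(k!·m!·(k−e)!)·x^{k−e} ≤ (a+b+e)!·2^{a+b+e+1}/m!`. -/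
theorem klgt_sum_Icc_tailCoeff_le_half {x : ℝ} (hx0 : 0 ≤ x) (hx : x ≤ 1 / 2) (a b e m N : ℕ) :
    ∑ k ∈ Icc e N, ((k + a)! * (k + b)! : ℝ) / (k ! * m ! * (k - e)!) * x ^ (k - e) ≤
      ((a + b + e)! : ℝ) * 2 ^ (a + b + e + 1) / m ! := by
  refine (klgt_sum_Icc_tailCoeff_le hx0 (by linarith) a b e m N).trans ?_
  have h := klgt_one_div_one_sub_pow_le hx (a + b + e + 1)
  rw [show ((a + b + e)! : ℝ) / (m ! * (1 - x) ^ (a + b + e + 1)) = (a + b + e)! / m ! * (1 / (1 - x) ^ (a + b + e + 1)) by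
    rw [mul_one_div, div_div], show ((a + b + e)! : ℝ) * 2 ^ (a + b + e + 1) / m ! = (a + b + e)! / m ! * 2 ^ (a + b + e + 1) by ring]
  exact mul_le_mul_of_nonneg_left h (by positivity)

/-- **`k`-weighted tail at `x ≤ 1/2`**: `≤ (a+b+e+1)!·2^{a+b+e+2}/m!`. -/
theorem klgt_sum_Icc_tailCoeff_mul_le_half {x : ℝ} (hx0 : 0 ≤ x) (hx : x ≤ 1 / 2) (a b e m N : ℕ) :
    ∑ k ∈ Icc e N, (k : ℝ) * (((k + a)! * (k + b)! : ℝ) / (k ! * m ! * (k - e)!)) * x ^ (k - e) ≤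
      ((a + b + e + 1)! : ℝ) * 2 ^ (a + b + e + 2) / m ! := by
  refine (klgt_sum_Icc_tailCoeff_mul_le hx0 (by linarith) a b e m N).trans ?_
  have h := klgt_one_div_one_sub_pow_le hx (a + b + e + 2)
  rw [show ((a + b + e + 1)! : ℝ) / (m ! * (1 - x) ^ (a + b + e + 2)) = (a + b + e + 1)! / m ! * (1 / (1 - x) ^ (a + b + e + 2)) by
    rw [mul_one_div, div_div], show ((a + b + e + 1)! : ℝ) * 2 ^ (a + b + e + 2) / m ! = (a + b + e + 1)! / m ! * 2 ^ (a + b + e + 2) by ring]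
  exact mul_le_mul_of_nonneg_left h (by positivity)

/-! ## §3 Consumer forms: per-`k` bounds of the bridge's shape ⟹ a bound of the sum -/

section Consumer

variable {E : Type*} [SeminormedAddCommGroup E]

/-- **Tail of the line-number series, weight `(k!)⁻¹`**: if every term `k ∈ [e, N]` is bounded by
`(k+a)!(k+b)!/(k!·m!·(k−e)!)·x^{k−e}·A` (the g5 bridge value/norm form times the exponential weight), the sum is
`≤ (a+b+e)!/(m!(1−x)^{a+b+e+1})·A`. -/
theorem klgt_norm_sum_le_of_tail (T : ℕ → E) {x A : ℝ} (hx0 : 0 ≤ x) (hx1 : x < 1) (hA : 0 ≤ A) (a b e m N : ℕ)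
    (hT : ∀ k ∈ Icc e N, ‖T k‖ ≤ ((k + a)! * (k + b)! : ℝ) / (k ! * m ! * (k - e)!) * x ^ (k - e) * A) :
    ‖∑ k ∈ Icc e N, T k‖ ≤ ((a + b + e)! : ℝ) / (m ! * (1 - x) ^ (a + b + e + 1)) * A := by
  calc ‖∑ k ∈ Icc e N, T k‖ ≤ ∑ k ∈ Icc e N, ‖T k‖ := norm_sum_le _ _
    _ ≤ ∑ k ∈ Icc e N, ((k + a)! * (k + b)! : ℝ) / (k ! * m ! * (k - e)!) * x ^ (k - e) * A := sum_le_sum hT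
    _ = (∑ k ∈ Icc e N, ((k + a)! * (k + b)! : ℝ) / (k ! * m ! * (k - e)!) * x ^ (k - e)) * A := by rw [sum_mul]
    _ ≤ ((a + b + e)! : ℝ) / (m ! * (1 - x) ^ (a + b + e + 1)) * A :=
        mul_le_mul_of_nonneg_right (klgt_sum_Icc_tailCoeff_le hx0 hx1 a b e m N) hA

/-- **Tail of the line-number series, weight `((k−1)!)⁻¹ = k/k!`** (continuous source: `l = k − 1` soft lines with `(l!)⁻¹`): if every term
`k ∈ [e, N]` is bounded by `k·(k+a)!(k+b)!/(k!·m!·(k−e)!)·x^{k−e}·A`, the sum is `≤ (a+b+e+1)!/(m!(1−x)^{a+b+e+2})·A`. -/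
theorem klgt_norm_sum_le_of_tail_mul (T : ℕ → E) {x A : ℝ} (hx0 : 0 ≤ x) (hx1 : x < 1) (hA : 0 ≤ A) (a b e m N : ℕ)
    (hT : ∀ k ∈ Icc e N, ‖T k‖ ≤ (k : ℝ) * (((k + a)! * (k + b)! : ℝ) / (k ! * m ! * (k - e)!)) * x ^ (k - e) * A) :
    ‖∑ k ∈ Icc e N, T k‖ ≤ ((a + b + e + 1)! : ℝ) / (m ! * (1 - x) ^ (a + b + e + 2)) * A := by
  calc ‖∑ k ∈ Icc e N, T k‖ ≤ ∑ k ∈ Icc e N, ‖T k‖ := norm_sum_le _ _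
    _ ≤ ∑ k ∈ Icc e N, (k : ℝ) * (((k + a)! * (k + b)! : ℝ) / (k ! * m ! * (k - e)!)) * x ^ (k - e) * A := sum_le_sum hT
    _ = (∑ k ∈ Icc e N, (k : ℝ) * (((k + a)! * (k + b)! : ℝ) / (k ! * m ! * (k - e)!)) * x ^ (k - e)) * A := by rw [sum_mul]
    _ ≤ ((a + b + e + 1)! : ℝ) / (m ! * (1 - x) ^ (a + b + e + 2)) * A :=
        mul_le_mul_of_nonneg_right (klgt_sum_Icc_tailCoeff_mul_le hx0 hx1 a b e m N) hA

/-- The `((k−1)!)⁻¹`-weighted coefficient IS `k·` the `(k!)⁻¹`-weighted one (`1 ≤ k`). -/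
theorem klgt_coeff_pred_factorial_eq {k : ℕ} (hk : 1 ≤ k) (a b m e : ℕ) :
    ((k + a)! * (k + b)! : ℝ) / ((k - 1)! * m ! * (k - e)!) = (k : ℝ) * (((k + a)! * (k + b)! : ℝ) / (k ! * m ! * (k - e)!)) := by
  obtain ⟨j, rfl⟩ := Nat.exists_eq_add_of_le hk
  rw [show 1 + j - 1 = j by omega, show 1 + j = j + 1 by ring, Nat.factorial_succ j]
  have hj : (0 : ℝ) < j ! := by positivity
  have hj1 : (0 : ℝ) < ((j + 1 : ℕ) : ℝ) := by positivity
  field_simp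
  push_cast
  ring

end Consumer

/-! ## §4 The envelope from geometric vertex growth (rev 2, p5 g6, skeleton-v2 prep (R47a))

In the assembled tail (`…GramTailValue`) the consumer owes ONE envelope `X^{k−e}·T k ≤ x^{k−e}·A` where `T k` is the product of the two vertex sizes
at line number `k`.  Under the U-currency export table ((R47a) `LevelsUAt`, geometric: `c (p+1) ≤ A·c p`) the vertex degrees grow by one on EACH side per
extra line, i.e. `T (k+2) ≤ ρ²·T k` along each parity class (`ρ = A_table·Klam|U|·8ⁿ` in tree units), the other parity vanishing.  The two lemmas below
turn that two-step growth into the envelope, so that `x = X·ρ` (`X = Σ_sκ_s² ≍ 8^{−n}` ⇒ `x ≍ A_table·Klam|U|`). -/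

section Envelope

/-- **Two-step geometric growth ⇒ geometric envelope**: if `0 ≤ f`, `0 ≤ ρ`, `f e ≤ F₀`, `f (e+1) ≤ F₀·ρ` and `f (k+2) ≤ ρ²·f k` for every `k ≥ e`, then
`f k ≤ F₀·ρ^{k−e}` for every `k ≥ e`. -/
theorem klgt_le_geom_of_two_step (f : ℕ → ℝ) {ρ F₀ : ℝ} (hρ : 0 ≤ ρ) {e : ℕ} (h0 : f e ≤ F₀) (h1 : f (e + 1) ≤ F₀ * ρ)
    (hstep : ∀ k, e ≤ k → f (k + 2) ≤ ρ ^ 2 * f k) : ∀ k, e ≤ k → f k ≤ F₀ * ρ ^ (k - e) := by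
  -- strong induction on the distance `k − e`
  suffices h : ∀ d k : ℕ, k = e + d → f k ≤ F₀ * ρ ^ d by
    intro k hk
    exact h (k - e) k (by omega)
  intro d
  induction d using Nat.strong_induction_on with
  | _ d ih =>
    intro k hk
    rcases d with _ | d
    · subst hk; simpa using h0
    rcases d with _ | d
    · subst hk; simpa using h1
    · -- d + 2: use the step from k − 2 = e + d
      have hk2 : k = (e + d) + 2 := by omega
      rw [hk2]
      refine (hstep (e + d) (by omega)).trans ?_
      have ih' := ih d (by omega) (e + d) rfl
      calc ρ ^ 2 * f (e + d) ≤ ρ ^ 2 * (F₀ * ρ ^ d) := mul_le_mul_of_nonneg_left ih' (pow_nonneg hρ 2)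
        _ = F₀ * ρ ^ (d + 1 + 1) := by ring

/-- **The envelope of `…GramTailValue` from geometric vertex growth**: with `0 ≤ X`, `0 ≤ ρ` and `T k ≤ F₀·ρ^{k−e}` on `[e, N]`,
`X^{k−e}·T k ≤ (X·ρ)^{k−e}·F₀` — i.e. the envelope hypothesis with `x := X·ρ`, `A := F₀`. -/
theorem klgt_envelope_of_geom (T : ℕ → ℝ) {X ρ F₀ : ℝ} (hX : 0 ≤ X) {e N : ℕ}
    (hT : ∀ k ∈ Icc e N, T k ≤ F₀ * ρ ^ (k - e)) : ∀ k ∈ Icc e N, X ^ (k - e) * T k ≤ (X * ρ) ^ (k - e) * F₀ := by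
  intro k hk
  calc X ^ (k - e) * T k ≤ X ^ (k - e) * (F₀ * ρ ^ (k - e)) := mul_le_mul_of_nonneg_left (hT k hk) (pow_nonneg hX _)
    _ = (X * ρ) ^ (k - e) * F₀ := by rw [mul_pow]; ring

/-- The two combined: two-step growth of `T` from `e` on ⇒ the envelope with `x = X·ρ`, `A = F₀`. -/
theorem klgt_envelope_of_two_step (T : ℕ → ℝ) {X ρ F₀ : ℝ} (hX : 0 ≤ X) (hρ : 0 ≤ ρ) {e N : ℕ} (h0 : T e ≤ F₀) (h1 : T (e + 1) ≤ F₀ * ρ)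
    (hstep : ∀ k, e ≤ k → T (k + 2) ≤ ρ ^ 2 * T k) : ∀ k ∈ Icc e N, X ^ (k - e) * T k ≤ (X * ρ) ^ (k - e) * F₀ :=
  klgt_envelope_of_geom T hX fun k hk => klgt_le_geom_of_two_step T hρ h0 h1 hstep k (mem_Icc.1 hk).1

end Envelope

end Summit.HubbardSuperconductivity.HubbardSuperconductivity.Theorems.KLRegimeWick
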